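import Summits.CriticalPhenomena.PercolationContinuityZ3.Theorems.PercNearOneGluingNoHeavyLowerTailSahiCombMixFourOfFivePatterns
import Summits.CriticalPhenomena.PercolationContinuityZ3.Theorems.PercNearOneGluingNoHeavyLowerTailSahiCombMixSubtopFiveD
import Summits.CriticalPhenomena.PercolationContinuityZ3.Theorems.PercNearOneGluingNoHeavyLowerTailSahiCombMixAllFive
import Summits.CriticalPhenomena.PercolationContinuityZ3.Theorems.PercNearOneGluingNoHeavyLowerTailSahiCombMixSingleOrAll
import Summits.CriticalPhenomena.PercolationContinuityZ3.Theorems.PercNearOneGluingNoHeavyLowerTailSahiCombMixFourOfFivePrelim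

/-!
# The comb hierarchy for Sahi's `E_k`, XCIX: **COMB H-MIX(5), THE `|G| = 4` RUNG** — OR-ing a fresh coordinate into FOUR of five events preserves the hereditary
# comb class; hence comb H-MIX(5) holds for every `|G| ∉ {2, 3}`

Support file of the one-cut programme (crux `NoHeavyLowerTail`, stmt-CriticalPhenomena-4575; cell `prim-masterthm`, seat P3, gen 12; HIERARCHY.md §20).  THE ASSEMBLY.  For a
`CombHereditary` quintuple `U` of increasing events ignoring `e` and `G4 = (T,T,T,T,F)`, an irredundant row of `orCoord U e G4` with slot map `K` is a row of the OR-ed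
DERIVED family `(⋂_{K_0∖4}U, …, U_4)` (`biInter_orCoord_G4`, `slotG4_in/out`, `…FourOfFivePrelim`): order `≤ 3` — comb H-MIX(4) (`combHereditary_orCoord_four`) on the derived
quadruple; order `4` — one of the sixteen PATTERN cells (`S = ∅`: comb H-MIX(4) on `(⋂_{K_j∖4}U)_j` all OR-ed; `S ≠ ∅`: `combPos_g4pat_<S>`, `…FourOfFivePatterns`, transported
LP certificates); order `5` — SUBTOP(5) (`combPos_five_orCoord_subtop`).  RESULTS: **`combHereditary_orCoord_five_four`**, **`combHereditary_orCoord_five_allBut(')`** (any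
untouched member).  With `combHereditary_orCoord_sel` (`|G| = 1`, every `n`, gen 11) and `combHereditary_orCoord_five_all` (`|G| = 5`): **comb H-MIX(5) holds whenever
`|G| ∉ {2, 3}`**; `|G| ∈ {2, 3}` is false already at the law level (`…SahiMixtureHereditaryCex5`, `…SahiMixtureSingletonFiveThree`).
HONEST FRAMING: closure properties of the hereditary comb class of five events; nothing here asserts (M⁺-k) or `C_k` for `k ≥ 3`. [this work]
-/


noncomputable section

open scoped Classical

namespace Summit.CriticalPhenomena.PercolationContinuityZ3.Theorems

open Finset Function
open Literature.Combinatorics.Sahi2008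
open Literature.Probability.Percolation.DecisionTree (ind)
open SahiComb
open SahiMixture (Irredundant)
open SahiCombDisjunct (orCoord)
open SahiCombHereditary (CombHereditary combHereditary_of_irredundant exists_perm_of_irredundant isUpperSet_biInter)

variable {ι : Type} [Fintype ι]

namespace SahiCombMix

set_option maxHeartbeats 1600000 in
/-- **COMB H-MIX(5), THE `|G| = 4` RUNG.**  For every finite cube, every quintuple `U` of increasing events ignoring `e` with `CombHereditary U`, the family with
`{e ∈ ω}` OR-ed into `U_0, U_1, U_2, U_3` (member `4` untouched) is again `CombHereditary`. [this work] -/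
theorem combHereditary_orCoord_five_four (U : Fin 5 → Set (Set ι)) (e : ι)
    (hUup : ∀ j, IsUpperSet (U j)) (hUe : ∀ (j : Fin 5) (b : Bool), secAt e b (U j) = U j) (hU : CombHereditary U) :
    CombHereditary (orCoord U e (![true, true, true, true, false] : Fin 5 → Bool)) := by
  refine combHereditary_of_irredundant _ fun m K hK => ?_
  have hm : m ≤ 5 := hK.card_le
  have hsec : ∀ (L : Finset (Fin 5)) (b : Bool), secAt e b (⋂ l ∈ L, U l) = ⋂ l ∈ L, U l := fun L b => secAt_biInter U e hUe L b
  rcases Nat.lt_or_ge m 4 with hm3 | hm4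
  · -- order ≤ 3: comb H-MIX(4) on the derived quadruple (⋂_{K_0∖4}U, ⋂_{K_1∖4}U, ⋂_{K_2∖4}U, U_4) with the coordinate OR-ed into its first three members
    have hm3' : m ≤ 3 := by omega
    let T : Fin 4 → Finset (Fin 5) := fun a => if h : a.val < m then (K ⟨a.val, h⟩).erase 4 else if a.val = 3 then {4} else ∅
    let Z : Fin 4 → Set (Set ι) := fun a => ⋂ l ∈ T a, U l
    have hZ : CombHereditary Z := hU.of_eq_biInter T (fun a => rfl)
    have hZup : ∀ a, IsUpperSet (Z a) := fun a => isUpperSet_biInter hUup _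
    have hZe : ∀ (a : Fin 4) (b : Bool), secAt e b (Z a) = Z a := fun a b => hsec _ b
    let G' : Fin 4 → Bool := fun a => decide (a.val < 3)
    have H := combHereditary_orCoord_four Z e G' hZup hZe hZ
    have hm4' : m ≤ 4 := by omega
    let K'' : Fin m → Finset (Fin 4) := fun j => if (4 : Fin 5) ∈ K j then {Fin.castLE hm4' j, 3} else {Fin.castLE hm4' j}
    refine (H m K'').congr fun p => ?_
    congr 1
    funext j
    have hjm : (Fin.castLE hm4' j).val < m := by simp
    have hj3 : (Fin.castLE hm4' j).val < 3 := lt_of_lt_of_le hjm hm3'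
    have Za : Z (Fin.castLE hm4' j) = ⋂ l ∈ (K j).erase 4, U l := by
      show (⋂ l ∈ T (Fin.castLE hm4' j), U l) = ⋂ l ∈ (K j).erase 4, U l
      have hT : T (Fin.castLE hm4' j) = (K j).erase 4 := by
        simp only [T, dif_pos hjm]
        rfl
      rw [hT]
    have Z3 : Z 3 = U 4 := by
      show (⋂ l ∈ T 3, U l) = U 4
      have hT : T 3 = {4} := by
        have h3 : ¬ ((3 : Fin 4).val < m) := by simp; omega
        simp only [T, dif_neg h3]
        rfl
      rw [hT, Finset.set_biInter_singleton]
    have oa : orCoord Z e G' (Fin.castLE hm4' j) = Z (Fin.castLE hm4' j) ∪ {ω : Set ι | e ∈ ω} := by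
      have hG : G' (Fin.castLE hm4' j) = true := by simp only [G', hj3, decide_true]
      simp only [SahiCombDisjunct.orCoord, hG, cond_true]
    have o3 : orCoord Z e G' 3 = Z 3 := by
      have hG : G' 3 = false := by simp [G']
      simp only [SahiCombDisjunct.orCoord, hG, cond_false]
    have hne3 : Fin.castLE hm4' j ≠ 3 := fun h => by
      have := congrArg Fin.val h
      simp at this
      omega
    by_cases h4 : (4 : Fin 5) ∈ K j
    · have hK'' : K'' j = {Fin.castLE hm4' j, 3} := by simp only [K'', if_pos h4]
      rw [hK'', Finset.set_biInter_insert, Finset.set_biInter_singleton, oa, o3, Za, Z3, biInter_orCoord_G4 U e (K j), if_pos h4]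
    · have hK'' : K'' j = {Fin.castLE hm4' j} := by simp only [K'', if_neg h4]
      rw [hK'', Finset.set_biInter_singleton, oa, Za, biInter_orCoord_G4 U e (K j), if_neg h4, Set.inter_univ]
  rcases Nat.lt_or_ge m 5 with hm5 | hm5
  · -- order 4: the derived quintuple W' = (⋂_{K_0∖4}U, …, ⋂_{K_3∖4}U, U_4) and one of the sixteen pattern cells
    obtain rfl : m = 4 := by omega
    set W' : Fin 5 → Set (Set ι) := fun l => ⋂ i ∈ (![(K 0).erase 4, (K 1).erase 4, (K 2).erase 4, (K 3).erase 4, {4}] : Fin 5 → Finset (Fin 5)) l, U i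
      with hW'
    have hW'her : CombHereditary W' := hU.of_eq_biInter (![(K 0).erase 4, (K 1).erase 4, (K 2).erase 4, (K 3).erase 4, {4}] : Fin 5 → Finset (Fin 5)) (fun _ => rfl)
    have hW'up : ∀ j, IsUpperSet (W' j) := fun j => isUpperSet_biInter hUup _
    have hW'e : ∀ (j : Fin 5) (b : Bool), secAt e b (W' j) = W' j := fun j b => hsec _ b
    have h4' : W' 4 = U 4 := by simp [hW']
    have e0 : W' 0 = ⋂ l ∈ (K 0).erase 4, U l := by simp [hW']
    have e1 : W' 1 = ⋂ l ∈ (K 1).erase 4, U l := by simp [hW']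
    have e2 : W' 2 = ⋂ l ∈ (K 2).erase 4, U l := by simp [hW']
    have e3 : W' 3 = ⋂ l ∈ (K 3).erase 4, U l := by simp [hW']
    -- the slots, in/out of member 4
    have sIn : ∀ (j : Fin 4) (t : Fin 5) (ht : t ≠ 4) (ht' : W' t = ⋂ l ∈ (K j).erase 4, U l), (4 : Fin 5) ∈ K j → ind (⋂ l ∈ K j, orCoord U e (![true, true, true, true, false] : Fin 5 → Bool) l)
          = ind (⋂ l ∈ ({t, 4} : Finset (Fin 5)), orCoord W' e (![true, true, true, true, false] : Fin 5 → Bool) l) := fun j t ht ht' h => congrArg ind (slotG4_in U W' e (K j) h t ht h4' ht')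
    have sOut : ∀ (j : Fin 4) (t : Fin 5) (ht : t ≠ 4) (ht' : W' t = ⋂ l ∈ (K j).erase 4, U l), (4 : Fin 5) ∉ K j → ind (⋂ l ∈ K j, orCoord U e (![true, true, true, true, false] : Fin 5 → Bool) l)
          = ind (⋂ l ∈ ({t} : Finset (Fin 5)), orCoord W' e (![true, true, true, true, false] : Fin 5 → Bool) l) := fun j t ht ht' h => congrArg ind (slotG4_out U W' e (K j) h t ht ht')
    by_cases h0 : (4 : Fin 5) ∈ K 0 <;> by_cases h1 : (4 : Fin 5) ∈ K 1 <;> by_cases h2 : (4 : Fin 5) ∈ K 2 <;> by_cases h3 : (4 : Fin 5) ∈ K 3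
    · -- pattern S = {0,1,2,3}
      have eK : (fun j => ind (⋂ l ∈ K j, orCoord U e (![true, true, true, true, false] : Fin 5 → Bool) l))
          = fun j => ind (⋂ l ∈ (![({0, 4} : Finset (Fin 5)), ({1, 4} : Finset (Fin 5)), ({2, 4} : Finset (Fin 5)), ({3, 4} : Finset (Fin 5))] : Fin 4 → Finset (Fin 5)) j, orCoord W' e (![true, true, true, true, false] : Fin 5 → Bool) l) := by
        funext j; fin_cases j
        · show ind (⋂ l ∈ K 0, orCoord U e (![true, true, true, true, false] : Fin 5 → Bool) l) = ind (⋂ l ∈ ({0, 4} : Finset (Fin 5)), orCoord W' e (![true, true, true, true, false] : Fin 5 → Bool) l)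
          exact sIn 0 0 (by decide) e0 h0
        · show ind (⋂ l ∈ K 1, orCoord U e (![true, true, true, true, false] : Fin 5 → Bool) l) = ind (⋂ l ∈ ({1, 4} : Finset (Fin 5)), orCoord W' e (![true, true, true, true, false] : Fin 5 → Bool) l)
          exact sIn 1 1 (by decide) e1 h1
        · show ind (⋂ l ∈ K 2, orCoord U e (![true, true, true, true, false] : Fin 5 → Bool) l) = ind (⋂ l ∈ ({2, 4} : Finset (Fin 5)), orCoord W' e (![true, true, true, true, false] : Fin 5 → Bool) l)
          exact sIn 2 2 (by decide) e2 h2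
        · show ind (⋂ l ∈ K 3, orCoord U e (![true, true, true, true, false] : Fin 5 → Bool) l) = ind (⋂ l ∈ ({3, 4} : Finset (Fin 5)), orCoord W' e (![true, true, true, true, false] : Fin 5 → Bool) l)
          exact sIn 3 3 (by decide) e3 h3
      refine (combPos_g4pat_1111 W' e hW'e hW'her).congr fun p => ?_
      rw [eK]
    · -- pattern S = {0,1,2}
      have eK : (fun j => ind (⋂ l ∈ K j, orCoord U e (![true, true, true, true, false] : Fin 5 → Bool) l))
          = fun j => ind (⋂ l ∈ (![({0, 4} : Finset (Fin 5)), ({1, 4} : Finset (Fin 5)), ({2, 4} : Finset (Fin 5)), ({3} : Finset (Fin 5))] : Fin 4 → Finset (Fin 5)) j, orCoord W' e (![true, true, true, true, false] : Fin 5 → Bool) l) := by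
        funext j; fin_cases j
        · show ind (⋂ l ∈ K 0, orCoord U e (![true, true, true, true, false] : Fin 5 → Bool) l) = ind (⋂ l ∈ ({0, 4} : Finset (Fin 5)), orCoord W' e (![true, true, true, true, false] : Fin 5 → Bool) l)
          exact sIn 0 0 (by decide) e0 h0
        · show ind (⋂ l ∈ K 1, orCoord U e (![true, true, true, true, false] : Fin 5 → Bool) l) = ind (⋂ l ∈ ({1, 4} : Finset (Fin 5)), orCoord W' e (![true, true, true, true, false] : Fin 5 → Bool) l)
          exact sIn 1 1 (by decide) e1 h1
        · show ind (⋂ l ∈ K 2, orCoord U e (![true, true, true, true, false] : Fin 5 → Bool) l) = ind (⋂ l ∈ ({2, 4} : Finset (Fin 5)), orCoord W' e (![true, true, true, true, false] : Fin 5 → Bool) l)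
          exact sIn 2 2 (by decide) e2 h2
        · show ind (⋂ l ∈ K 3, orCoord U e (![true, true, true, true, false] : Fin 5 → Bool) l) = ind (⋂ l ∈ ({3} : Finset (Fin 5)), orCoord W' e (![true, true, true, true, false] : Fin 5 → Bool) l)
          exact sOut 3 3 (by decide) e3 h3
      refine (combPos_g4pat_1110 W' e hW'e hW'her).congr fun p => ?_
      rw [eK]
    · -- pattern S = {0,1,3}
      have eK : (fun j => ind (⋂ l ∈ K j, orCoord U e (![true, true, true, true, false] : Fin 5 → Bool) l))
          = fun j => ind (⋂ l ∈ (![({0, 4} : Finset (Fin 5)), ({1, 4} : Finset (Fin 5)), ({2} : Finset (Fin 5)), ({3, 4} : Finset (Fin 5))] : Fin 4 → Finset (Fin 5)) j, orCoord W' e (![true, true, true, true, false] : Fin 5 → Bool) l) := by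
        funext j; fin_cases j
        · show ind (⋂ l ∈ K 0, orCoord U e (![true, true, true, true, false] : Fin 5 → Bool) l) = ind (⋂ l ∈ ({0, 4} : Finset (Fin 5)), orCoord W' e (![true, true, true, true, false] : Fin 5 → Bool) l)
          exact sIn 0 0 (by decide) e0 h0
        · show ind (⋂ l ∈ K 1, orCoord U e (![true, true, true, true, false] : Fin 5 → Bool) l) = ind (⋂ l ∈ ({1, 4} : Finset (Fin 5)), orCoord W' e (![true, true, true, true, false] : Fin 5 → Bool) l)
          exact sIn 1 1 (by decide) e1 h1
        · show ind (⋂ l ∈ K 2, orCoord U e (![true, true, true, true, false] : Fin 5 → Bool) l) = ind (⋂ l ∈ ({2} : Finset (Fin 5)), orCoord W' e (![true, true, true, true, false] : Fin 5 → Bool) l)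
          exact sOut 2 2 (by decide) e2 h2
        · show ind (⋂ l ∈ K 3, orCoord U e (![true, true, true, true, false] : Fin 5 → Bool) l) = ind (⋂ l ∈ ({3, 4} : Finset (Fin 5)), orCoord W' e (![true, true, true, true, false] : Fin 5 → Bool) l)
          exact sIn 3 3 (by decide) e3 h3
      refine (combPos_g4pat_1101 W' e hW'e hW'her).congr fun p => ?_
      rw [eK]
    · -- pattern S = {0,1}
      have eK : (fun j => ind (⋂ l ∈ K j, orCoord U e (![true, true, true, true, false] : Fin 5 → Bool) l))
          = fun j => ind (⋂ l ∈ (![({0, 4} : Finset (Fin 5)), ({1, 4} : Finset (Fin 5)), ({2} : Finset (Fin 5)), ({3} : Finset (Fin 5))] : Fin 4 → Finset (Fin 5)) j, orCoord W' e (![true, true, true, true, false] : Fin 5 → Bool) l) := by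
        funext j; fin_cases j
        · show ind (⋂ l ∈ K 0, orCoord U e (![true, true, true, true, false] : Fin 5 → Bool) l) = ind (⋂ l ∈ ({0, 4} : Finset (Fin 5)), orCoord W' e (![true, true, true, true, false] : Fin 5 → Bool) l)
          exact sIn 0 0 (by decide) e0 h0
        · show ind (⋂ l ∈ K 1, orCoord U e (![true, true, true, true, false] : Fin 5 → Bool) l) = ind (⋂ l ∈ ({1, 4} : Finset (Fin 5)), orCoord W' e (![true, true, true, true, false] : Fin 5 → Bool) l)
          exact sIn 1 1 (by decide) e1 h1
        · show ind (⋂ l ∈ K 2, orCoord U e (![true, true, true, true, false] : Fin 5 → Bool) l) = ind (⋂ l ∈ ({2} : Finset (Fin 5)), orCoord W' e (![true, true, true, true, false] : Fin 5 → Bool) l)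
          exact sOut 2 2 (by decide) e2 h2
        · show ind (⋂ l ∈ K 3, orCoord U e (![true, true, true, true, false] : Fin 5 → Bool) l) = ind (⋂ l ∈ ({3} : Finset (Fin 5)), orCoord W' e (![true, true, true, true, false] : Fin 5 → Bool) l)
          exact sOut 3 3 (by decide) e3 h3
      refine (combPos_g4pat_1100 W' e hW'e hW'her).congr fun p => ?_
      rw [eK]
    · -- pattern S = {0,2,3}
      have eK : (fun j => ind (⋂ l ∈ K j, orCoord U e (![true, true, true, true, false] : Fin 5 → Bool) l))
          = fun j => ind (⋂ l ∈ (![({0, 4} : Finset (Fin 5)), ({1} : Finset (Fin 5)), ({2, 4} : Finset (Fin 5)), ({3, 4} : Finset (Fin 5))] : Fin 4 → Finset (Fin 5)) j, orCoord W' e (![true, true, true, true, false] : Fin 5 → Bool) l) := by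
        funext j; fin_cases j
        · show ind (⋂ l ∈ K 0, orCoord U e (![true, true, true, true, false] : Fin 5 → Bool) l) = ind (⋂ l ∈ ({0, 4} : Finset (Fin 5)), orCoord W' e (![true, true, true, true, false] : Fin 5 → Bool) l)
          exact sIn 0 0 (by decide) e0 h0
        · show ind (⋂ l ∈ K 1, orCoord U e (![true, true, true, true, false] : Fin 5 → Bool) l) = ind (⋂ l ∈ ({1} : Finset (Fin 5)), orCoord W' e (![true, true, true, true, false] : Fin 5 → Bool) l)
          exact sOut 1 1 (by decide) e1 h1
        · show ind (⋂ l ∈ K 2, orCoord U e (![true, true, true, true, false] : Fin 5 → Bool) l) = ind (⋂ l ∈ ({2, 4} : Finset (Fin 5)), orCoord W' e (![true, true, true, true, false] : Fin 5 → Bool) l)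
          exact sIn 2 2 (by decide) e2 h2
        · show ind (⋂ l ∈ K 3, orCoord U e (![true, true, true, true, false] : Fin 5 → Bool) l) = ind (⋂ l ∈ ({3, 4} : Finset (Fin 5)), orCoord W' e (![true, true, true, true, false] : Fin 5 → Bool) l)
          exact sIn 3 3 (by decide) e3 h3
      refine (combPos_g4pat_1011 W' e hW'e hW'her).congr fun p => ?_
      rw [eK]
    · -- pattern S = {0,2}
      have eK : (fun j => ind (⋂ l ∈ K j, orCoord U e (![true, true, true, true, false] : Fin 5 → Bool) l))
          = fun j => ind (⋂ l ∈ (![({0, 4} : Finset (Fin 5)), ({1} : Finset (Fin 5)), ({2, 4} : Finset (Fin 5)), ({3} : Finset (Fin 5))] : Fin 4 → Finset (Fin 5)) j, orCoord W' e (![true, true, true, true, false] : Fin 5 → Bool) l) := by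
        funext j; fin_cases j
        · show ind (⋂ l ∈ K 0, orCoord U e (![true, true, true, true, false] : Fin 5 → Bool) l) = ind (⋂ l ∈ ({0, 4} : Finset (Fin 5)), orCoord W' e (![true, true, true, true, false] : Fin 5 → Bool) l)
          exact sIn 0 0 (by decide) e0 h0
        · show ind (⋂ l ∈ K 1, orCoord U e (![true, true, true, true, false] : Fin 5 → Bool) l) = ind (⋂ l ∈ ({1} : Finset (Fin 5)), orCoord W' e (![true, true, true, true, false] : Fin 5 → Bool) l)
          exact sOut 1 1 (by decide) e1 h1
        · show ind (⋂ l ∈ K 2, orCoord U e (![true, true, true, true, false] : Fin 5 → Bool) l) = ind (⋂ l ∈ ({2, 4} : Finset (Fin 5)), orCoord W' e (![true, true, true, true, false] : Fin 5 → Bool) l)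
          exact sIn 2 2 (by decide) e2 h2
        · show ind (⋂ l ∈ K 3, orCoord U e (![true, true, true, true, false] : Fin 5 → Bool) l) = ind (⋂ l ∈ ({3} : Finset (Fin 5)), orCoord W' e (![true, true, true, true, false] : Fin 5 → Bool) l)
          exact sOut 3 3 (by decide) e3 h3
      refine (combPos_g4pat_1010 W' e hW'e hW'her).congr fun p => ?_
      rw [eK]
    · -- pattern S = {0,3}
      have eK : (fun j => ind (⋂ l ∈ K j, orCoord U e (![true, true, true, true, false] : Fin 5 → Bool) l))
          = fun j => ind (⋂ l ∈ (![({0, 4} : Finset (Fin 5)), ({1} : Finset (Fin 5)), ({2} : Finset (Fin 5)), ({3, 4} : Finset (Fin 5))] : Fin 4 → Finset (Fin 5)) j, orCoord W' e (![true, true, true, true, false] : Fin 5 → Bool) l) := by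
        funext j; fin_cases j
        · show ind (⋂ l ∈ K 0, orCoord U e (![true, true, true, true, false] : Fin 5 → Bool) l) = ind (⋂ l ∈ ({0, 4} : Finset (Fin 5)), orCoord W' e (![true, true, true, true, false] : Fin 5 → Bool) l)
          exact sIn 0 0 (by decide) e0 h0
        · show ind (⋂ l ∈ K 1, orCoord U e (![true, true, true, true, false] : Fin 5 → Bool) l) = ind (⋂ l ∈ ({1} : Finset (Fin 5)), orCoord W' e (![true, true, true, true, false] : Fin 5 → Bool) l)
          exact sOut 1 1 (by decide) e1 h1
        · show ind (⋂ l ∈ K 2, orCoord U e (![true, true, true, true, false] : Fin 5 → Bool) l) = ind (⋂ l ∈ ({2} : Finset (Fin 5)), orCoord W' e (![true, true, true, true, false] : Fin 5 → Bool) l)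
          exact sOut 2 2 (by decide) e2 h2
        · show ind (⋂ l ∈ K 3, orCoord U e (![true, true, true, true, false] : Fin 5 → Bool) l) = ind (⋂ l ∈ ({3, 4} : Finset (Fin 5)), orCoord W' e (![true, true, true, true, false] : Fin 5 → Bool) l)
          exact sIn 3 3 (by decide) e3 h3
      refine (combPos_g4pat_1001 W' e hW'e hW'her).congr fun p => ?_
      rw [eK]
    · -- pattern S = {0}
      have eK : (fun j => ind (⋂ l ∈ K j, orCoord U e (![true, true, true, true, false] : Fin 5 → Bool) l))
          = fun j => ind (⋂ l ∈ (![({0, 4} : Finset (Fin 5)), ({1} : Finset (Fin 5)), ({2} : Finset (Fin 5)), ({3} : Finset (Fin 5))] : Fin 4 → Finset (Fin 5)) j, orCoord W' e (![true, true, true, true, false] : Fin 5 → Bool) l) := by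
        funext j; fin_cases j
        · show ind (⋂ l ∈ K 0, orCoord U e (![true, true, true, true, false] : Fin 5 → Bool) l) = ind (⋂ l ∈ ({0, 4} : Finset (Fin 5)), orCoord W' e (![true, true, true, true, false] : Fin 5 → Bool) l)
          exact sIn 0 0 (by decide) e0 h0
        · show ind (⋂ l ∈ K 1, orCoord U e (![true, true, true, true, false] : Fin 5 → Bool) l) = ind (⋂ l ∈ ({1} : Finset (Fin 5)), orCoord W' e (![true, true, true, true, false] : Fin 5 → Bool) l)
          exact sOut 1 1 (by decide) e1 h1
        · show ind (⋂ l ∈ K 2, orCoord U e (![true, true, true, true, false] : Fin 5 → Bool) l) = ind (⋂ l ∈ ({2} : Finset (Fin 5)), orCoord W' e (![true, true, true, true, false] : Fin 5 → Bool) l)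
          exact sOut 2 2 (by decide) e2 h2
        · show ind (⋂ l ∈ K 3, orCoord U e (![true, true, true, true, false] : Fin 5 → Bool) l) = ind (⋂ l ∈ ({3} : Finset (Fin 5)), orCoord W' e (![true, true, true, true, false] : Fin 5 → Bool) l)
          exact sOut 3 3 (by decide) e3 h3
      refine (combPos_g4pat_1000 W' e hW'e hW'her).congr fun p => ?_
      rw [eK]
    · -- pattern S = {1,2,3}
      have eK : (fun j => ind (⋂ l ∈ K j, orCoord U e (![true, true, true, true, false] : Fin 5 → Bool) l))
          = fun j => ind (⋂ l ∈ (![({0} : Finset (Fin 5)), ({1, 4} : Finset (Fin 5)), ({2, 4} : Finset (Fin 5)), ({3, 4} : Finset (Fin 5))] : Fin 4 → Finset (Fin 5)) j, orCoord W' e (![true, true, true, true, false] : Fin 5 → Bool) l) := by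
        funext j; fin_cases j
        · show ind (⋂ l ∈ K 0, orCoord U e (![true, true, true, true, false] : Fin 5 → Bool) l) = ind (⋂ l ∈ ({0} : Finset (Fin 5)), orCoord W' e (![true, true, true, true, false] : Fin 5 → Bool) l)
          exact sOut 0 0 (by decide) e0 h0
        · show ind (⋂ l ∈ K 1, orCoord U e (![true, true, true, true, false] : Fin 5 → Bool) l) = ind (⋂ l ∈ ({1, 4} : Finset (Fin 5)), orCoord W' e (![true, true, true, true, false] : Fin 5 → Bool) l)
          exact sIn 1 1 (by decide) e1 h1
        · show ind (⋂ l ∈ K 2, orCoord U e (![true, true, true, true, false] : Fin 5 → Bool) l) = ind (⋂ l ∈ ({2, 4} : Finset (Fin 5)), orCoord W' e (![true, true, true, true, false] : Fin 5 → Bool) l)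
          exact sIn 2 2 (by decide) e2 h2
        · show ind (⋂ l ∈ K 3, orCoord U e (![true, true, true, true, false] : Fin 5 → Bool) l) = ind (⋂ l ∈ ({3, 4} : Finset (Fin 5)), orCoord W' e (![true, true, true, true, false] : Fin 5 → Bool) l)
          exact sIn 3 3 (by decide) e3 h3
      refine (combPos_g4pat_0111 W' e hW'e hW'her).congr fun p => ?_
      rw [eK]
    · -- pattern S = {1,2}
      have eK : (fun j => ind (⋂ l ∈ K j, orCoord U e (![true, true, true, true, false] : Fin 5 → Bool) l))
          = fun j => ind (⋂ l ∈ (![({0} : Finset (Fin 5)), ({1, 4} : Finset (Fin 5)), ({2, 4} : Finset (Fin 5)), ({3} : Finset (Fin 5))] : Fin 4 → Finset (Fin 5)) j, orCoord W' e (![true, true, true, true, false] : Fin 5 → Bool) l) := by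
        funext j; fin_cases j
        · show ind (⋂ l ∈ K 0, orCoord U e (![true, true, true, true, false] : Fin 5 → Bool) l) = ind (⋂ l ∈ ({0} : Finset (Fin 5)), orCoord W' e (![true, true, true, true, false] : Fin 5 → Bool) l)
          exact sOut 0 0 (by decide) e0 h0
        · show ind (⋂ l ∈ K 1, orCoord U e (![true, true, true, true, false] : Fin 5 → Bool) l) = ind (⋂ l ∈ ({1, 4} : Finset (Fin 5)), orCoord W' e (![true, true, true, true, false] : Fin 5 → Bool) l)
          exact sIn 1 1 (by decide) e1 h1
        · show ind (⋂ l ∈ K 2, orCoord U e (![true, true, true, true, false] : Fin 5 → Bool) l) = ind (⋂ l ∈ ({2, 4} : Finset (Fin 5)), orCoord W' e (![true, true, true, true, false] : Fin 5 → Bool) l)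
          exact sIn 2 2 (by decide) e2 h2
        · show ind (⋂ l ∈ K 3, orCoord U e (![true, true, true, true, false] : Fin 5 → Bool) l) = ind (⋂ l ∈ ({3} : Finset (Fin 5)), orCoord W' e (![true, true, true, true, false] : Fin 5 → Bool) l)
          exact sOut 3 3 (by decide) e3 h3
      refine (combPos_g4pat_0110 W' e hW'e hW'her).congr fun p => ?_
      rw [eK]
    · -- pattern S = {1,3}
      have eK : (fun j => ind (⋂ l ∈ K j, orCoord U e (![true, true, true, true, false] : Fin 5 → Bool) l))
          = fun j => ind (⋂ l ∈ (![({0} : Finset (Fin 5)), ({1, 4} : Finset (Fin 5)), ({2} : Finset (Fin 5)), ({3, 4} : Finset (Fin 5))] : Fin 4 → Finset (Fin 5)) j, orCoord W' e (![true, true, true, true, false] : Fin 5 → Bool) l) := by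
        funext j; fin_cases j
        · show ind (⋂ l ∈ K 0, orCoord U e (![true, true, true, true, false] : Fin 5 → Bool) l) = ind (⋂ l ∈ ({0} : Finset (Fin 5)), orCoord W' e (![true, true, true, true, false] : Fin 5 → Bool) l)
          exact sOut 0 0 (by decide) e0 h0
        · show ind (⋂ l ∈ K 1, orCoord U e (![true, true, true, true, false] : Fin 5 → Bool) l) = ind (⋂ l ∈ ({1, 4} : Finset (Fin 5)), orCoord W' e (![true, true, true, true, false] : Fin 5 → Bool) l)
          exact sIn 1 1 (by decide) e1 h1
        · show ind (⋂ l ∈ K 2, orCoord U e (![true, true, true, true, false] : Fin 5 → Bool) l) = ind (⋂ l ∈ ({2} : Finset (Fin 5)), orCoord W' e (![true, true, true, true, false] : Fin 5 → Bool) l)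
          exact sOut 2 2 (by decide) e2 h2
        · show ind (⋂ l ∈ K 3, orCoord U e (![true, true, true, true, false] : Fin 5 → Bool) l) = ind (⋂ l ∈ ({3, 4} : Finset (Fin 5)), orCoord W' e (![true, true, true, true, false] : Fin 5 → Bool) l)
          exact sIn 3 3 (by decide) e3 h3
      refine (combPos_g4pat_0101 W' e hW'e hW'her).congr fun p => ?_
      rw [eK]
    · -- pattern S = {1}
      have eK : (fun j => ind (⋂ l ∈ K j, orCoord U e (![true, true, true, true, false] : Fin 5 → Bool) l))
          = fun j => ind (⋂ l ∈ (![({0} : Finset (Fin 5)), ({1, 4} : Finset (Fin 5)), ({2} : Finset (Fin 5)), ({3} : Finset (Fin 5))] : Fin 4 → Finset (Fin 5)) j, orCoord W' e (![true, true, true, true, false] : Fin 5 → Bool) l) := by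
        funext j; fin_cases j
        · show ind (⋂ l ∈ K 0, orCoord U e (![true, true, true, true, false] : Fin 5 → Bool) l) = ind (⋂ l ∈ ({0} : Finset (Fin 5)), orCoord W' e (![true, true, true, true, false] : Fin 5 → Bool) l)
          exact sOut 0 0 (by decide) e0 h0
        · show ind (⋂ l ∈ K 1, orCoord U e (![true, true, true, true, false] : Fin 5 → Bool) l) = ind (⋂ l ∈ ({1, 4} : Finset (Fin 5)), orCoord W' e (![true, true, true, true, false] : Fin 5 → Bool) l)
          exact sIn 1 1 (by decide) e1 h1
        · show ind (⋂ l ∈ K 2, orCoord U e (![true, true, true, true, false] : Fin 5 → Bool) l) = ind (⋂ l ∈ ({2} : Finset (Fin 5)), orCoord W' e (![true, true, true, true, false] : Fin 5 → Bool) l)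
          exact sOut 2 2 (by decide) e2 h2
        · show ind (⋂ l ∈ K 3, orCoord U e (![true, true, true, true, false] : Fin 5 → Bool) l) = ind (⋂ l ∈ ({3} : Finset (Fin 5)), orCoord W' e (![true, true, true, true, false] : Fin 5 → Bool) l)
          exact sOut 3 3 (by decide) e3 h3
      refine (combPos_g4pat_0100 W' e hW'e hW'her).congr fun p => ?_
      rw [eK]
    · -- pattern S = {2,3}
      have eK : (fun j => ind (⋂ l ∈ K j, orCoord U e (![true, true, true, true, false] : Fin 5 → Bool) l))
          = fun j => ind (⋂ l ∈ (![({0} : Finset (Fin 5)), ({1} : Finset (Fin 5)), ({2, 4} : Finset (Fin 5)), ({3, 4} : Finset (Fin 5))] : Fin 4 → Finset (Fin 5)) j, orCoord W' e (![true, true, true, true, false] : Fin 5 → Bool) l) := by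
        funext j; fin_cases j
        · show ind (⋂ l ∈ K 0, orCoord U e (![true, true, true, true, false] : Fin 5 → Bool) l) = ind (⋂ l ∈ ({0} : Finset (Fin 5)), orCoord W' e (![true, true, true, true, false] : Fin 5 → Bool) l)
          exact sOut 0 0 (by decide) e0 h0
        · show ind (⋂ l ∈ K 1, orCoord U e (![true, true, true, true, false] : Fin 5 → Bool) l) = ind (⋂ l ∈ ({1} : Finset (Fin 5)), orCoord W' e (![true, true, true, true, false] : Fin 5 → Bool) l)
          exact sOut 1 1 (by decide) e1 h1
        · show ind (⋂ l ∈ K 2, orCoord U e (![true, true, true, true, false] : Fin 5 → Bool) l) = ind (⋂ l ∈ ({2, 4} : Finset (Fin 5)), orCoord W' e (![true, true, true, true, false] : Fin 5 → Bool) l)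
          exact sIn 2 2 (by decide) e2 h2
        · show ind (⋂ l ∈ K 3, orCoord U e (![true, true, true, true, false] : Fin 5 → Bool) l) = ind (⋂ l ∈ ({3, 4} : Finset (Fin 5)), orCoord W' e (![true, true, true, true, false] : Fin 5 → Bool) l)
          exact sIn 3 3 (by decide) e3 h3
      refine (combPos_g4pat_0011 W' e hW'e hW'her).congr fun p => ?_
      rw [eK]
    · -- pattern S = {2}
      have eK : (fun j => ind (⋂ l ∈ K j, orCoord U e (![true, true, true, true, false] : Fin 5 → Bool) l))
          = fun j => ind (⋂ l ∈ (![({0} : Finset (Fin 5)), ({1} : Finset (Fin 5)), ({2, 4} : Finset (Fin 5)), ({3} : Finset (Fin 5))] : Fin 4 → Finset (Fin 5)) j, orCoord W' e (![true, true, true, true, false] : Fin 5 → Bool) l) := by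
        funext j; fin_cases j
        · show ind (⋂ l ∈ K 0, orCoord U e (![true, true, true, true, false] : Fin 5 → Bool) l) = ind (⋂ l ∈ ({0} : Finset (Fin 5)), orCoord W' e (![true, true, true, true, false] : Fin 5 → Bool) l)
          exact sOut 0 0 (by decide) e0 h0
        · show ind (⋂ l ∈ K 1, orCoord U e (![true, true, true, true, false] : Fin 5 → Bool) l) = ind (⋂ l ∈ ({1} : Finset (Fin 5)), orCoord W' e (![true, true, true, true, false] : Fin 5 → Bool) l)
          exact sOut 1 1 (by decide) e1 h1
        · show ind (⋂ l ∈ K 2, orCoord U e (![true, true, true, true, false] : Fin 5 → Bool) l) = ind (⋂ l ∈ ({2, 4} : Finset (Fin 5)), orCoord W' e (![true, true, true, true, false] : Fin 5 → Bool) l)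
          exact sIn 2 2 (by decide) e2 h2
        · show ind (⋂ l ∈ K 3, orCoord U e (![true, true, true, true, false] : Fin 5 → Bool) l) = ind (⋂ l ∈ ({3} : Finset (Fin 5)), orCoord W' e (![true, true, true, true, false] : Fin 5 → Bool) l)
          exact sOut 3 3 (by decide) e3 h3
      refine (combPos_g4pat_0010 W' e hW'e hW'her).congr fun p => ?_
      rw [eK]
    · -- pattern S = {3}
      have eK : (fun j => ind (⋂ l ∈ K j, orCoord U e (![true, true, true, true, false] : Fin 5 → Bool) l))
          = fun j => ind (⋂ l ∈ (![({0} : Finset (Fin 5)), ({1} : Finset (Fin 5)), ({2} : Finset (Fin 5)), ({3, 4} : Finset (Fin 5))] : Fin 4 → Finset (Fin 5)) j, orCoord W' e (![true, true, true, true, false] : Fin 5 → Bool) l) := by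
        funext j; fin_cases j
        · show ind (⋂ l ∈ K 0, orCoord U e (![true, true, true, true, false] : Fin 5 → Bool) l) = ind (⋂ l ∈ ({0} : Finset (Fin 5)), orCoord W' e (![true, true, true, true, false] : Fin 5 → Bool) l)
          exact sOut 0 0 (by decide) e0 h0
        · show ind (⋂ l ∈ K 1, orCoord U e (![true, true, true, true, false] : Fin 5 → Bool) l) = ind (⋂ l ∈ ({1} : Finset (Fin 5)), orCoord W' e (![true, true, true, true, false] : Fin 5 → Bool) l)
          exact sOut 1 1 (by decide) e1 h1
        · show ind (⋂ l ∈ K 2, orCoord U e (![true, true, true, true, false] : Fin 5 → Bool) l) = ind (⋂ l ∈ ({2} : Finset (Fin 5)), orCoord W' e (![true, true, true, true, false] : Fin 5 → Bool) l)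
          exact sOut 2 2 (by decide) e2 h2
        · show ind (⋂ l ∈ K 3, orCoord U e (![true, true, true, true, false] : Fin 5 → Bool) l) = ind (⋂ l ∈ ({3, 4} : Finset (Fin 5)), orCoord W' e (![true, true, true, true, false] : Fin 5 → Bool) l)
          exact sIn 3 3 (by decide) e3 h3
      refine (combPos_g4cell_k0_1_2_34f15 W' e hW'e hW'her).congr fun p => ?_
      rw [eK]
    · -- pattern S = ∅: member 4 unused — comb H-MIX(4) on (W'_0, …, W'_3), all four OR-ed
      let V4 : Fin 4 → Set (Set ι) := fun a => W' (Fin.castSucc a)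
      have hV4 : CombHereditary V4 := hW'her.of_eq_biInter (fun a => ({Fin.castSucc a} : Finset (Fin 5))) (fun a => by
        show W' (Fin.castSucc a) = ⋂ i ∈ ({Fin.castSucc a} : Finset (Fin 5)), W' i
        rw [Finset.set_biInter_singleton])
      have hV4up : ∀ a, IsUpperSet (V4 a) := fun a => hW'up _
      have hV4e : ∀ (a : Fin 4) (b : Bool), secAt e b (V4 a) = V4 a := fun a b => hW'e _ b
      have H4 := combHereditary_orCoord_four V4 e (fun _ => true) hV4up hV4e hV4
      have eK : (fun j => ind (⋂ l ∈ K j, orCoord U e (![true, true, true, true, false] : Fin 5 → Bool) l))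
          = fun j => ind (⋂ l ∈ ({j} : Finset (Fin 4)), orCoord V4 e (fun _ => true) l) := by
        funext j; fin_cases j
        · show ind (⋂ l ∈ K 0, orCoord U e (![true, true, true, true, false] : Fin 5 → Bool) l) = ind (⋂ l ∈ ({0} : Finset (Fin 4)), orCoord V4 e (fun _ => true) l)
          rw [sOut 0 0 (by decide) e0 h0, Finset.set_biInter_singleton, Finset.set_biInter_singleton,
            orCoord_G4_of_ne W' e (by decide : (0 : Fin 5) ≠ 4), orCoord_all_apply]
          rfl
        · show ind (⋂ l ∈ K 1, orCoord U e (![true, true, true, true, false] : Fin 5 → Bool) l) = ind (⋂ l ∈ ({1} : Finset (Fin 4)), orCoord V4 e (fun _ => true) l)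
          rw [sOut 1 1 (by decide) e1 h1, Finset.set_biInter_singleton, Finset.set_biInter_singleton,
            orCoord_G4_of_ne W' e (by decide : (1 : Fin 5) ≠ 4), orCoord_all_apply]
          rfl
        · show ind (⋂ l ∈ K 2, orCoord U e (![true, true, true, true, false] : Fin 5 → Bool) l) = ind (⋂ l ∈ ({2} : Finset (Fin 4)), orCoord V4 e (fun _ => true) l)
          rw [sOut 2 2 (by decide) e2 h2, Finset.set_biInter_singleton, Finset.set_biInter_singleton,
            orCoord_G4_of_ne W' e (by decide : (2 : Fin 5) ≠ 4), orCoord_all_apply]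
          rfl
        · show ind (⋂ l ∈ K 3, orCoord U e (![true, true, true, true, false] : Fin 5 → Bool) l) = ind (⋂ l ∈ ({3} : Finset (Fin 4)), orCoord V4 e (fun _ => true) l)
          rw [sOut 3 3 (by decide) e3 h3, Finset.set_biInter_singleton, Finset.set_biInter_singleton,
            orCoord_G4_of_ne W' e (by decide : (3 : Fin 5) ≠ 4), orCoord_all_apply]
          rfl
      refine (H4 4 (fun j => ({j} : Finset (Fin 4)))).congr fun p => ?_
      rw [eK]
  · -- order 5: singleton slots, the SUBTOP(5) cell
    obtain rfl : m = 5 := le_antisymm hm hm5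
    obtain ⟨σ, hσ⟩ := exists_perm_of_irredundant hK
    have eK : (fun j => ind (⋂ l ∈ K j, orCoord U e (![true, true, true, true, false] : Fin 5 → Bool) l))
        = fun j => (fun l => ind (orCoord U e (![true, true, true, true, false] : Fin 5 → Bool) l)) (σ j) := by
      funext j; rw [hσ j, Finset.set_biInter_singleton]
    refine (combPos_five_orCoord_subtop U e hUe hU).congr fun p => ?_
    rw [eK, sahiE_comp_perm (bernoulliWeight p) 5 σ (fun l => ind (orCoord U e (![true, true, true, true, false] : Fin 5 → Bool) l))]
/-- Law-level shadow: for every product measure, `(U_0∪{e∈ω}, …, U_3∪{e∈ω}, U_4)` is hereditarily all-orders positive. [this work] -/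
theorem hereditaryAllOrders_orCoord_five_four (U : Fin 5 → Set (Set ι)) (e : ι)
    (hUup : ∀ j, IsUpperSet (U j)) (hUe : ∀ (j : Fin 5) (b : Bool), secAt e b (U j) = U j) (hU : CombHereditary U) (p : ι → unitInterval) :
    SahiMixture.HereditaryAllOrders (bernoulliWeight p) (orCoord U e (![true, true, true, true, false] : Fin 5 → Bool)) :=
  (combHereditary_orCoord_five_four U e hUup hUe hU).hereditaryAllOrders p

/-! ### Any untouched member; the ladder -/

/-- **Any untouched member `u`**: OR-ing `{e ∈ ω}` into the four members other than `u` preserves `CombHereditary`. [this work] -/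
theorem combHereditary_orCoord_five_allBut (U : Fin 5 → Set (Set ι)) (e : ι) (u : Fin 5)
    (hUup : ∀ j, IsUpperSet (U j)) (hUe : ∀ (j : Fin 5) (b : Bool), secAt e b (U j) = U j) (hU : CombHereditary U) :
    CombHereditary (orCoord U e ((![true, true, true, true, false] : Fin 5 → Bool) ∘ (Equiv.swap u 4))) := by
  set π : Equiv.Perm (Fin 5) := Equiv.swap u 4 with hπ
  have h := combHereditary_orCoord_five_four (U ∘ π) e (fun j => hUup (π j)) (fun j b => hUe (π j) b) (hU.reindex π)
  rw [orCoord_swap_G4] at h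
  have h2 := h.reindex π
  have hππ : ((orCoord U e ((![true, true, true, true, false] : Fin 5 → Bool) ∘ ⇑π)) ∘ ⇑π) ∘ ⇑π
      = orCoord U e ((![true, true, true, true, false] : Fin 5 → Bool) ∘ ⇑π) := by
    funext l; simp [hπ, Equiv.swap_apply_self]
  rw [hππ] at h2
  exact h2

/-- **COMB H-MIX(5) FOR `|G| = 4`**, selector form: for every `u`, `CombHereditary (orCoord U e (fun j => j ≠ u))`. [this work] -/
theorem combHereditary_orCoord_five_allBut' (U : Fin 5 → Set (Set ι)) (e : ι) (u : Fin 5)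
    (hUup : ∀ j, IsUpperSet (U j)) (hUe : ∀ (j : Fin 5) (b : Bool), secAt e b (U j) = U j) (hU : CombHereditary U) :
    CombHereditary (orCoord U e (fun j : Fin 5 => decide (j ≠ u))) := by
  rw [allBut_eq_swap]; exact combHereditary_orCoord_five_allBut U e u hUup hUe hU

/-- Law-level shadow: every row of the family with the coordinate OR-ed into all members but `u` is nonnegative under every product measure. [this work] -/
theorem sahiE_orCoord_five_allBut_row_nonneg (U : Fin 5 → Set (Set ι)) (e : ι) (u : Fin 5)
    (hUup : ∀ j, IsUpperSet (U j)) (hUe : ∀ (j : Fin 5) (b : Bool), secAt e b (U j) = U j) (hU : CombHereditary U)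
    (p : ι → unitInterval) (m : ℕ) (K : Fin m → Finset (Fin 5)) :
    0 ≤ sahiE (bernoulliWeight p) m (fun j => ind (⋂ l ∈ K j, orCoord U e (fun j : Fin 5 => decide (j ≠ u)) l)) :=
  ((combHereditary_orCoord_five_allBut' U e u hUup hUe hU) m K).nonneg p

end SahiCombMix

end Summit.CriticalPhenomena.PercolationContinuityZ3.Theorems

end
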